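import Summits.QuantumFields.QCD.Theses.EulerDescent
import Literature.MathematicalPhysics.QuantumFieldTheory.QCDGoldstoneBound
import Literature.MathematicalPhysics.QuantumFieldTheory.QCDAsymptoticScalingCouplingDivergence

/-!
# The intrinsic Wilson corner of `EulerDescent.HonestHeavyAnchor` (stmt-QuantumFields-16901), stub
# `stub_intrinsicCorner` of line `bounded_locator`: order-theoretic ASSEMBLY and the typed split
# "massive barrier at weak coupling" + "closing Wilson-axis transition"

The registered stub `stub_intrinsicCorner` (shared with `Lines/birth.lean`) reads: for `N_f ∈ {2,3}` and every
regularisation `reg` whose couplings scale asymptotically, there is `mc : ℕ → ℝ` with, EVENTUALLY in `k`,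
`IsLUB (NonMassive N_f (reg.β k)) (mc k)` and `mc k → 0`, where `NonMassive N_f β` (inlined below exactly as in the
route file) is the set of degenerate bare Wilson masses `μ` at which lattice QCD at inverse coupling `β` is NOT
massive (some pair of gauge-invariant local observables fails to cluster exponentially in Euclidean time at any
lattice rate uniformly in the torus side).  It is open-problem grade: `IsLUB` in `ℝ` forces the set to be NON-EMPTY
(a transition point on the Wilson mass axis at every large `β` — Aoki edge / Sharpe–Singleton coexistence) and
BOUNDED ABOVE with every larger `μ` massive (clustering of lattice QCD with heavy Wilson quarks, hence of the pure
`SU(3)` gauge sector, at FIXED weak coupling — for `N_f = 0` Chatterjee's open problem; in the tree only the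
strong-coupling pure-gauge case `osterwalderSeiler_clustering_holds` is proved, and the hopping-expansion barriers
`HoppingExpansionLocality` / `HoppingExpansionUniformGap` localise quark lines only inside `|κ| < 1/8`).

This def-free file does NOT prove the stub.  It lands the bookkeeping by which the stub SPLITS into two one-sided
statements with distinct physics, in the exact typed form a reshape would register, and names the existing ledger
statement that carries the upper half:

* §1 (generic order bookkeeping on `ℝ`, for any family of sets `N k`): a member `μ₀ ∈ N` and a massive barrier `u`
  (`∀ μ ≥ u, μ ∉ N`) give `IsLUB N (sSup N)` with `μ₀ ≤ sSup N ≤ u` (`isLUB_csSup`); eventually-in-`k` versions; the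
  squeeze `μ₀ k → 0`, `u k → 0 ⇒ sSup (N k) → 0`; and the sharper WINDOW form — (n) `∀ ε > 0, ∀ᶠ k, ∃ μ ∈ N k, −ε < μ`
  and (b) `∀ ε > 0, ∀ᶠ k, ∀ μ ≥ ε, μ ∉ N k` — which is EQUIVALENT to "eventually `IsLUB (N k) (mc k)` and `mc → 0`"
  (`exists_corner_of_windows`, `windows_of_corner`): the split loses nothing.
* §2 (the crux's inlined set): the stub follows from two FIXED-COUPLING statements about lattice QCD —
  (B) **massive barrier at weak coupling**: `∀ ε > 0, ∃ β₀, ∀ β ≥ β₀`, every degenerate bare mass `μ ≥ ε` is massive;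
  (N) **closing Wilson-axis transition**: `∀ ε > 0, ∃ β₀, ∀ β ≥ β₀`, some `μ > −ε` is non-massive —
  transported along `β_k → +∞` (`QCDRegularisation.tendsto_beta_atTop_of_hasAsymptoticScaling`, `N_f ≤ 16`):
  `intrinsicCorner_of_weakCouplingBarrier_of_closingTransition` (registered sub-goal of the item).  (B) is implied by
  the typed ledger statement `GluonFreeDual.AllCouplingClustering` (item stmt-QuantumFields-9713: volume-uniform
  exponential clustering of `SU(3)` lattice QCD with `N_f ≤ 3` Wilson quarks of positive bare mass at EVERY `β ≥ 0`;
  inlined verbatim, not imported): `weakCouplingBarrier_of_allCouplingClustering`, hence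
  `intrinsicCorner_of_allCouplingClustering_of_closingTransition`.  (N) is stated by no ledger item (the idea cards'
  `Stmt.BranchTransition` asks only `μ > −1/2`, which does not give `mc → 0`); it is the missing statement.
* §3 (necessity): conversely the stub gives the sequential windows (n), (b) along every asymptotically scaling
  regularisation (`windows_of_intrinsicCorner`).

Sources (physics of the two halves, not used in proofs): MontvayMunster1994 §5.1 ((5.59)–(5.62): one loop
`K_cr = ⅛(1 + 0.651 β⁻¹ + …)`, i.e. `a m_cr → 0⁻`; p. 233: `K_cr(π) = 1/4` at `β = 0`), SharpeSingleton1998,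
Aoki1984WilsonPhase, OsterwalderSeiler1978 §§2–4.  Axioms: standard (`propext`, `Classical.choice`, `Quot.sound`).
-/

namespace Summit.QuantumFields.QCD.Theorems.HonestHeavyAnchorIntrinsicCorner

open Filter Topology
open Literature.MathematicalPhysics.QuantumFieldTheory

/-! ## §1 Order bookkeeping on the real line -/

/-- **Corner sandwich (pointwise).**  If `μ₀ ∈ N` and every `μ ≥ u` lies outside `N`, then `N ⊆ ℝ` has the least
upper bound `sSup N`, and `μ₀ ≤ sSup N ≤ u`. [folklore] -/
theorem isLUB_sSup_of_mem_of_barrier (N : Set ℝ) (μ₀ u : ℝ) (hμ₀ : μ₀ ∈ N)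
    (hu : ∀ μ : ℝ, u ≤ μ → μ ∉ N) : IsLUB N (sSup N) ∧ μ₀ ≤ sSup N ∧ sSup N ≤ u := by
  have hub : u ∈ upperBounds N := fun μ hμ => (not_le.1 fun h => hu μ h hμ).le
  have hlub : IsLUB N (sSup N) := isLUB_csSup ⟨μ₀, hμ₀⟩ ⟨u, hub⟩
  exact ⟨hlub, hlub.1 hμ₀, hlub.2 hub⟩

/-- **Corner sandwich (eventually).**  For a family of sets `N k ⊆ ℝ`: if eventually `μ₀ k ∈ N k` and eventually
every `μ ≥ u k` lies outside `N k`, then eventually `IsLUB (N k) (sSup (N k))` with `μ₀ k ≤ sSup (N k) ≤ u k`.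
[folklore] -/
theorem eventually_isLUB_sSup_sandwich (N : ℕ → Set ℝ) (μ₀ u : ℕ → ℝ)
    (hμ₀ : ∀ᶠ k in atTop, μ₀ k ∈ N k) (hu : ∀ᶠ k in atTop, ∀ μ : ℝ, u k ≤ μ → μ ∉ N k) :
    ∀ᶠ k in atTop, IsLUB (N k) (sSup (N k)) ∧ μ₀ k ≤ sSup (N k) ∧ sSup (N k) ≤ u k := by
  filter_upwards [hμ₀, hu] with k h₁ h₂
  exact isLUB_sSup_of_mem_of_barrier (N k) (μ₀ k) (u k) h₁ h₂

/-- **Corner by squeeze.**  If eventually `μ₀ k ∈ N k`, eventually every `μ ≥ u k` lies outside `N k`, and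
`μ₀ k → 0`, `u k → 0`, then `mc k := sSup (N k)` is eventually the least upper bound of `N k` and `mc k → 0`.
[folklore] -/
theorem exists_corner_of_squeeze (N : ℕ → Set ℝ) (μ₀ u : ℕ → ℝ)
    (hμ₀ : ∀ᶠ k in atTop, μ₀ k ∈ N k) (hu : ∀ᶠ k in atTop, ∀ μ : ℝ, u k ≤ μ → μ ∉ N k)
    (h₀ : Tendsto μ₀ atTop (𝓝 0)) (h₁ : Tendsto u atTop (𝓝 0)) :
    ∃ mc : ℕ → ℝ, (∀ᶠ k in atTop, IsLUB (N k) (mc k)) ∧ Tendsto mc atTop (𝓝 0) := by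
  have h := eventually_isLUB_sSup_sandwich N μ₀ u hμ₀ hu
  exact ⟨fun k => sSup (N k), h.mono fun k hk => hk.1,
    tendsto_of_tendsto_of_tendsto_of_le_of_le' h₀ h₁ (h.mono fun k hk => hk.2.1) (h.mono fun k hk => hk.2.2)⟩

/-- **Corner from the two WINDOWS** (the sharp form of the split).  For a family of sets `N k ⊆ ℝ`: if
(n) for every `ε > 0` eventually some member of `N k` exceeds `−ε`, and (b) for every `ε > 0` eventually every
`μ ≥ ε` lies outside `N k`, then `mc k := sSup (N k)` is eventually the least upper bound of `N k` and `mc k → 0`.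
[folklore] -/
theorem exists_corner_of_windows (N : ℕ → Set ℝ)
    (hn : ∀ ε : ℝ, 0 < ε → ∀ᶠ k in atTop, ∃ μ ∈ N k, -ε < μ)
    (hb : ∀ ε : ℝ, 0 < ε → ∀ᶠ k in atTop, ∀ μ : ℝ, ε ≤ μ → μ ∉ N k) :
    ∃ mc : ℕ → ℝ, (∀ᶠ k in atTop, IsLUB (N k) (mc k)) ∧ Tendsto mc atTop (𝓝 0) := by
  have hsand : ∀ ε : ℝ, 0 < ε →
      ∀ᶠ k in atTop, IsLUB (N k) (sSup (N k)) ∧ -ε < sSup (N k) ∧ sSup (N k) ≤ ε := by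
    intro ε hε
    filter_upwards [hn ε hε, hb ε hε] with k h₁ h₂
    obtain ⟨μ, hμ, hεμ⟩ := h₁
    obtain ⟨hl, hμle, hle⟩ := isLUB_sSup_of_mem_of_barrier (N k) μ ε hμ h₂
    exact ⟨hl, hεμ.trans_le hμle, hle⟩
  refine ⟨fun k => sSup (N k), (hsand 1 one_pos).mono fun k hk => hk.1, Metric.tendsto_nhds.2 fun ε hε => ?_⟩
  filter_upwards [hsand (ε / 2) (half_pos hε)] with k hk
  rw [Real.dist_eq, sub_zero, abs_lt]
  constructor <;> linarith [hk.2.1, hk.2.2]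

/-- **The split loses nothing**: conversely, if eventually `IsLUB (N k) (mc k)` and `mc k → 0`, then both windows
hold — (n) for every `ε > 0` eventually some member of `N k` exceeds `−ε`, and (b) for every `ε > 0` eventually
every `μ ≥ ε` lies outside `N k`. [folklore] -/
theorem windows_of_corner (N : ℕ → Set ℝ) (mc : ℕ → ℝ)
    (h : ∀ᶠ k in atTop, IsLUB (N k) (mc k)) (h0 : Tendsto mc atTop (𝓝 0)) :
    (∀ ε : ℝ, 0 < ε → ∀ᶠ k in atTop, ∃ μ ∈ N k, -ε < μ) ∧
      (∀ ε : ℝ, 0 < ε → ∀ᶠ k in atTop, ∀ μ : ℝ, ε ≤ μ → μ ∉ N k) := by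
  constructor
  · intro ε hε
    filter_upwards [h, h0.eventually_const_lt (neg_lt_zero.2 hε)] with k hk hlt
    obtain ⟨μ, hμ, hεμ, -⟩ := hk.exists_between hlt
    exact ⟨μ, hμ, hεμ⟩
  · intro ε hε
    filter_upwards [h, h0.eventually_lt_const hε] with k hk hlt μ hεμ hμN
    exact absurd (hk.1 hμN) (not_le.2 (hlt.trans_le hεμ))

/-! ## §2 The crux's inlined corner set: the stub from two fixed-coupling halves -/

/-- **The intrinsic Wilson corner from the two fixed-coupling halves** (registered sub-goal; conclusion VERBATIM
the registered stub `stub_intrinsicCorner` of `Cruxes/HonestHeavyAnchor/Lines/bounded_locator.lean`).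
Hypothesis 1 (B, massive barrier at weak coupling — contains `SU(3)` lattice Yang–Mills clustering at fixed weak
`β`; implied by item stmt-QuantumFields-9713, see `weakCouplingBarrier_of_allCouplingClustering`): for
`N_f ∈ {2,3}` and every `ε > 0` there is `β₀` such that at every `β ≥ β₀` every degenerate bare Wilson mass `μ ≥ ε`
is massive.  Hypothesis 2 (N, closing Wilson-axis transition — the chiral transition point `a m_cr(β) → 0⁻`,
non-massive for the `(−1)^F`-twisted torus functional in both Sharpe–Singleton scenarios; stated by no ledger item):
for `N_f ∈ {2,3}` and every `ε > 0` there is `β₀` such that at every `β ≥ β₀` some `μ > −ε` is non-massive.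
Conclusion: along every asymptotically scaling regularisation (`β_k → +∞`) the corner `mc k := sup NonMassive(β_k)`
exists eventually and tends to `0`. [folklore] -/
theorem intrinsicCorner_of_weakCouplingBarrier_of_closingTransition :
    (∀ Nf : ℕ, Nf = 2 ∨ Nf = 3 → ∀ ε : ℝ, 0 < ε → ∃ β₀ : ℝ, ∀ β : ℝ, β₀ ≤ β → ∀ μ : ℝ, ε ≤ μ →
      ∀ (R R' : ℕ) (A : QCDLatticeObservable Nf R) (B : QCDLatticeObservable Nf R'),
        ∃ (C δ : ℝ) (S₀ : ℕ), 0 < δ ∧ ∀ S : ℕ, S₀ ≤ S → ∀ n : ℕ, n ≤ S →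
          ‖qcdLatticeConnectedCorr β (2 * S + 1) (fun _ : Fin Nf => μ) A B n‖ ≤ C * Real.exp (-(δ * n))) →
    (∀ Nf : ℕ, Nf = 2 ∨ Nf = 3 → ∀ ε : ℝ, 0 < ε → ∃ β₀ : ℝ, ∀ β : ℝ, β₀ ≤ β → ∃ μ : ℝ, -ε < μ ∧
      ¬ (∀ (R R' : ℕ) (A : QCDLatticeObservable Nf R) (B : QCDLatticeObservable Nf R'),
        ∃ (C δ : ℝ) (S₀ : ℕ), 0 < δ ∧ ∀ S : ℕ, S₀ ≤ S → ∀ n : ℕ, n ≤ S →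
          ‖qcdLatticeConnectedCorr β (2 * S + 1) (fun _ : Fin Nf => μ) A B n‖ ≤ C * Real.exp (-(δ * n)))) →
    ∀ Nf : ℕ, Nf = 2 ∨ Nf = 3 → ∀ reg : QCDRegularisation Nf, (reg.scheme 0 0 0).HasAsymptoticScaling →
      ∃ mc : ℕ → ℝ, (∀ᶠ k in atTop, IsLUB {μ : ℝ | ¬ (∀ (R R' : ℕ) (A : QCDLatticeObservable Nf R)
        (B : QCDLatticeObservable Nf R'), ∃ (C δ : ℝ) (S₀ : ℕ), 0 < δ ∧ ∀ S : ℕ, S₀ ≤ S → ∀ n : ℕ, n ≤ S →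
          ‖qcdLatticeConnectedCorr (reg.β k) (2 * S + 1) (fun _ : Fin Nf => μ) A B n‖ ≤ C * Real.exp (-(δ * n)))} (mc k)) ∧
        Tendsto mc atTop (𝓝 0) := by
  intro hB hN Nf hNf reg haf
  have hNf16 : Nf ≤ 16 := by rcases hNf with rfl | rfl <;> norm_num
  have hβ : Tendsto reg.β atTop atTop :=
    QCDRegularisation.tendsto_beta_atTop_of_hasAsymptoticScaling hNf16 reg 0 0 0 haf
  refine exists_corner_of_windows _ (fun ε hε => ?_) (fun ε hε => ?_)
  · obtain ⟨β₀, hβ₀⟩ := hN Nf hNf ε hε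
    filter_upwards [hβ.eventually_ge_atTop β₀] with k hk
    obtain ⟨μ, hεμ, hμ⟩ := hβ₀ (reg.β k) hk
    exact ⟨μ, hμ, hεμ⟩
  · obtain ⟨β₀, hβ₀⟩ := hB Nf hNf ε hε
    filter_upwards [hβ.eventually_ge_atTop β₀] with k hk μ hεμ hμN
    exact hμN (hβ₀ (reg.β k) hk μ hεμ)

/-- **The massive barrier at weak coupling from all-coupling clustering.**  The hypothesis is VERBATIM the
statement of `Summit.QuantumFields.QCD.Theses.GluonFreeDual.AllCouplingClustering` (item stmt-QuantumFields-9713: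
`SU(3)` lattice QCD with `N_f ≤ 3` Wilson quarks of strictly positive bare masses clusters exponentially in
Euclidean time in lattice units, uniformly in the volume, at EVERY `β ≥ 0`; inlined rather than imported so that
this file does not depend on that route file's build state).  It gives hypothesis (B) of
`intrinsicCorner_of_weakCouplingBarrier_of_closingTransition` with `β₀ := 0`, rate `δ := μ(N_f, β, m)` and
`S₀ := 0`: every positive degenerate bare mass is massive at every `β ≥ 0`. [folklore] -/
theorem weakCouplingBarrier_of_allCouplingClustering :
    (∀ (Nf : ℕ), Nf ≤ 3 → ∀ β : ℝ, 0 ≤ β → ∀ mq : Fin Nf → ℝ, (∀ f, 0 < mq f) → ∃ μ : ℝ, 0 < μ ∧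
      ∀ (R R' : ℕ) (A : QCDLatticeObservable Nf R) (B : QCDLatticeObservable Nf R'), ∃ C : ℝ,
        ∀ S n : ℕ, n ≤ S → ‖qcdLatticeConnectedCorr β (2 * S + 1) mq A B n‖ ≤ C * Real.exp (-(μ * n))) →
    ∀ Nf : ℕ, Nf = 2 ∨ Nf = 3 → ∀ ε : ℝ, 0 < ε → ∃ β₀ : ℝ, ∀ β : ℝ, β₀ ≤ β → ∀ μ : ℝ, ε ≤ μ →
      ∀ (R R' : ℕ) (A : QCDLatticeObservable Nf R) (B : QCDLatticeObservable Nf R'),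
        ∃ (C δ : ℝ) (S₀ : ℕ), 0 < δ ∧ ∀ S : ℕ, S₀ ≤ S → ∀ n : ℕ, n ≤ S →
          ‖qcdLatticeConnectedCorr β (2 * S + 1) (fun _ : Fin Nf => μ) A B n‖ ≤ C * Real.exp (-(δ * n)) := by
  intro hACC Nf hNf ε hε
  have hNf3 : Nf ≤ 3 := by rcases hNf with rfl | rfl <;> norm_num
  refine ⟨0, fun β hβ μ hεμ R R' A B => ?_⟩
  obtain ⟨δ, hδ, hclust⟩ := hACC Nf hNf3 β hβ (fun _ => μ) (fun _ => hε.trans_le hεμ)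
  obtain ⟨C, hC⟩ := hclust R R' A B
  exact ⟨C, δ, 0, hδ, fun S _ n hn => hC S n hn⟩

/-- **The stub from item stmt-QuantumFields-9713 and the closing Wilson-axis transition**: composing
`weakCouplingBarrier_of_allCouplingClustering` with `intrinsicCorner_of_weakCouplingBarrier_of_closingTransition`,
the registered stub `stub_intrinsicCorner` follows from `GluonFreeDual.AllCouplingClustering` (verbatim, hypothesis 1)
and the closing-transition statement (N) (hypothesis 2) alone. [folklore] -/
theorem intrinsicCorner_of_allCouplingClustering_of_closingTransition :
    (∀ (Nf : ℕ), Nf ≤ 3 → ∀ β : ℝ, 0 ≤ β → ∀ mq : Fin Nf → ℝ, (∀ f, 0 < mq f) → ∃ μ : ℝ, 0 < μ ∧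
      ∀ (R R' : ℕ) (A : QCDLatticeObservable Nf R) (B : QCDLatticeObservable Nf R'), ∃ C : ℝ,
        ∀ S n : ℕ, n ≤ S → ‖qcdLatticeConnectedCorr β (2 * S + 1) mq A B n‖ ≤ C * Real.exp (-(μ * n))) →
    (∀ Nf : ℕ, Nf = 2 ∨ Nf = 3 → ∀ ε : ℝ, 0 < ε → ∃ β₀ : ℝ, ∀ β : ℝ, β₀ ≤ β → ∃ μ : ℝ, -ε < μ ∧
      ¬ (∀ (R R' : ℕ) (A : QCDLatticeObservable Nf R) (B : QCDLatticeObservable Nf R'),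
        ∃ (C δ : ℝ) (S₀ : ℕ), 0 < δ ∧ ∀ S : ℕ, S₀ ≤ S → ∀ n : ℕ, n ≤ S →
          ‖qcdLatticeConnectedCorr β (2 * S + 1) (fun _ : Fin Nf => μ) A B n‖ ≤ C * Real.exp (-(δ * n)))) →
    ∀ Nf : ℕ, Nf = 2 ∨ Nf = 3 → ∀ reg : QCDRegularisation Nf, (reg.scheme 0 0 0).HasAsymptoticScaling →
      ∃ mc : ℕ → ℝ, (∀ᶠ k in atTop, IsLUB {μ : ℝ | ¬ (∀ (R R' : ℕ) (A : QCDLatticeObservable Nf R)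
        (B : QCDLatticeObservable Nf R'), ∃ (C δ : ℝ) (S₀ : ℕ), 0 < δ ∧ ∀ S : ℕ, S₀ ≤ S → ∀ n : ℕ, n ≤ S →
          ‖qcdLatticeConnectedCorr (reg.β k) (2 * S + 1) (fun _ : Fin Nf => μ) A B n‖ ≤ C * Real.exp (-(δ * n)))} (mc k)) ∧
        Tendsto mc atTop (𝓝 0) :=
  fun hACC hN => intrinsicCorner_of_weakCouplingBarrier_of_closingTransition
    (weakCouplingBarrier_of_allCouplingClustering hACC) hN

/-! ## §3 Necessity: the stub returns the sequential windows -/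

/-- **The stub implies both sequential windows** along every asymptotically scaling regularisation: for every
`ε > 0`, eventually in `k` some degenerate bare mass `μ > −ε` is non-massive at `β_k` (n), and eventually every
`μ ≥ ε` is massive at `β_k` (b) — so a reshape of `stub_intrinsicCorner` into "(n) and (b) along `reg.β`" is an
EQUIVALENT cut (`exists_corner_of_windows` is the converse). [folklore] -/
theorem windows_of_intrinsicCorner :
    (∀ Nf : ℕ, Nf = 2 ∨ Nf = 3 → ∀ reg : QCDRegularisation Nf, (reg.scheme 0 0 0).HasAsymptoticScaling →
      ∃ mc : ℕ → ℝ, (∀ᶠ k in atTop, IsLUB {μ : ℝ | ¬ (∀ (R R' : ℕ) (A : QCDLatticeObservable Nf R)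
        (B : QCDLatticeObservable Nf R'), ∃ (C δ : ℝ) (S₀ : ℕ), 0 < δ ∧ ∀ S : ℕ, S₀ ≤ S → ∀ n : ℕ, n ≤ S →
          ‖qcdLatticeConnectedCorr (reg.β k) (2 * S + 1) (fun _ : Fin Nf => μ) A B n‖ ≤ C * Real.exp (-(δ * n)))} (mc k)) ∧
        Tendsto mc atTop (𝓝 0)) →
    ∀ Nf : ℕ, Nf = 2 ∨ Nf = 3 → ∀ reg : QCDRegularisation Nf, (reg.scheme 0 0 0).HasAsymptoticScaling →
      (∀ ε : ℝ, 0 < ε → ∀ᶠ k in atTop, ∃ μ : ℝ, -ε < μ ∧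
        ¬ (∀ (R R' : ℕ) (A : QCDLatticeObservable Nf R) (B : QCDLatticeObservable Nf R'),
          ∃ (C δ : ℝ) (S₀ : ℕ), 0 < δ ∧ ∀ S : ℕ, S₀ ≤ S → ∀ n : ℕ, n ≤ S →
            ‖qcdLatticeConnectedCorr (reg.β k) (2 * S + 1) (fun _ : Fin Nf => μ) A B n‖ ≤ C * Real.exp (-(δ * n)))) ∧
      (∀ ε : ℝ, 0 < ε → ∀ᶠ k in atTop, ∀ μ : ℝ, ε ≤ μ →
        ∀ (R R' : ℕ) (A : QCDLatticeObservable Nf R) (B : QCDLatticeObservable Nf R'),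
          ∃ (C δ : ℝ) (S₀ : ℕ), 0 < δ ∧ ∀ S : ℕ, S₀ ≤ S → ∀ n : ℕ, n ≤ S →
            ‖qcdLatticeConnectedCorr (reg.β k) (2 * S + 1) (fun _ : Fin Nf => μ) A B n‖ ≤ C * Real.exp (-(δ * n))) := by
  intro h Nf hNf reg haf
  obtain ⟨mc, hc, h0⟩ := h Nf hNf reg haf
  obtain ⟨hn, hb⟩ := windows_of_corner _ mc hc h0
  refine ⟨fun ε hε => (hn ε hε).mono fun k hk => ?_, fun ε hε => (hb ε hε).mono fun k hk μ hεμ => ?_⟩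
  · obtain ⟨μ, hμ, hεμ⟩ := hk
    exact ⟨μ, hεμ, hμ⟩
  · exact not_not.1 (hk μ hεμ)

end Summit.QuantumFields.QCD.Theorems.HonestHeavyAnchorIntrinsicCorner
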